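import Summits.ResolutionOfSingularities.ResolutionOfSingularities.Theorems.GaloisDescentLU3
import Summits.ResolutionOfSingularities.ResolutionOfSingularities.Theorems.AdaptedChartHensel3
import Literature.AlgebraicGeometry.Resolution.TameCyclicEigenparameters
import HarnessLib

/-!
# EigenLadderLU — tame coming-down: the datum-producing law (decomp-res lens-1 g24, tree twin of the
node `Theses/EigenLadder`)

THESIS.  Grade the located residual `NonKHToricArchLUKeyHenselDescent 3 3 4` (g23: the places off
the key-chain, Hensel and descent cells) by the EIGEN-DEFECT of a tame cyclic cover: for a finite
cyclic tame Galois `K' | K` (`G = ⟨σ⟩`, `σ^ℓ = 1`, `(ℓ : k) ≠ 0`, `μ_ℓ ⊆ k`) with `G = G_Z` at a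
residually rational `O' ∣ O` and a value-adapted regular chart `(A, u)` UPSTAIRS (THEOREM H's
hypothesis, g22), let `ε := #{j : σ uⱼ ∉ k^× uⱼ}` be the number of NON-EIGEN parameters.  Rung `ε =
0` is the TAME EIGEN-CELL `TameEigenChartBelow k O` (PART G; characters `σ xⱼ = ζ^{tⱼ} xⱼ`, `t₀ =
1`; its Kummer face `t = (1,0,0,0)` is `TameKummerChartBelow k O`, PART E); every rung `ε ≤ 4` whose
coordinates are `σ`-stable TO FIRST ORDER (a flag chart: one relation `σ(uⱼ) bⱼ = aⱼ uⱼ`, `bⱼ` a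
unit, `aⱼ ≡ ζ^{tⱼ} bⱼ mod 𝔪'`) is brought down to `ε = 0` by the LAW OF THE LADDER (PART B, kernel,
hypothesis-free): the isotypic Reynolds projector `P_χ = ∑ χ^{-i} σⁱ` COMPUTES eigen-parameters `xⱼ
= P_{ζ^{tⱼ}}(uⱼ) = (αⱼ/βⱼ)·uⱼ` with `αⱼ ≡ ℓβⱼ` units (orbit cocycle, PART B2), so `(A, x)` is again
a VALUE-ADAPTED regular chart with the same values and the same centre (Cossart–Piltant's averaging
(29)–(30) = tree `exists_eigen_regularParameters_of_tameCyclic` [CoP1 6.2], here with the value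
control that [CoP] do not need and THEOREM H does; `eigenCoordinate_of_stableHyperplane`,
`eigenFrame_of_stableFlag`). THE DATUM-PRODUCING LAW (PART F, kernel, decided modulo THEOREM D =
window item (K-e″)): a tame eigen-chart upstairs PRODUCES g23's `GaloisHenselDescentDatum k O` —
upstairs frame `F' = k(x)` (`G`-stable since the `xⱼ` are eigenvectors), Hensel generator `η'` from
THEOREM H's standard-étale neighbourhood (`henselDatum_of_standardEtalePresentation`), and
DOWNSTAIRS sub-top `F₁ = F' ∩ K = F'^σ = k(W)`, `W = (x₀^ℓ, xⱼ x₀^{(ℓ-1)tⱼ})`, the field of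
INVARIANT MONOMIALS (PART C, kernel: the `σ`-invariants of `k(x)` lie in any subfield containing `k`
and the invariant Laurent monomials — isotypic projection `P_χ(aeval x P) = ℓ · isoPart`, no Galois
theory of `k(x) | k(x)^σ` needed — and PART C2: the explicit Hermite basis `W` of the invariant
exponent lattice `{b : ℓ ∣ ∑ bⱼ tⱼ}`, `fixed_iff_mem_adjoin_invGen`, `algebraicIndependent_invGen`),
which is MONOMIALLY RATIONAL (`v W₀ = ℓ v x₀`, `v Wⱼ = v xⱼ + (ℓ-1)tⱼ v x₀`: independence and
spanning transfer through a unimodular-times-`ℓ` change of exponents), hence key-chain by THEOREM D;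
`[K : F₁] < ∞` and `K | F₁` separable because `K' = F₁(x₀)(η')` with `X^ℓ − x₀^ℓ` separable (`ℓ ≠ 0`
in `k`) and `η'` a SIMPLE root.  Composed with g23 (`relLU_of_galoisHenselDescent`) and g22:
`TheoremD k → TameEigenChartBelow k O → RelLocalUniformization k K O`
(`relLU_of_tameEigenChartBelow`), and from the BARE flag chart
`galoisHenselDescentDatum_of_stableFlag` / `relLU_of_stableFlag` (NO downstairs frame given in
advance: every `uⱼ` may be moved by `σ`, the chart is not defined over `K`, the frame `x` and the
sub-top `k(W)` are COMPUTED); the Kummer specialisations are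
`galoisHenselDescentDatum_of_kummerChart` (PART D) and
`galoisHenselDescentDatum_of_stableHyperplane` (PART E2).

WHY THIS LINE.  (K-e″) of the g24 binding window (critic row 178): «AdaptedRegularChart of K′ at O′
+ tame G = G_Z ⇒ GaloisHenselDescentDatum k O in KERNEL (eigen-frame, invariant-monomial sub-top,
THEOREM H, TheoremD k as typed hypothesis ⇒ DECIDED-MOD-D), one instance with the frame not given in
advance».  g23 decided the descent cell GIVEN the datum; g24 PRODUCES the datum from chart-level
data upstairs, i.e. it completes tame coming-down to the same input THEOREM H consumes one level up.
What is imported from which area: representation theory of `ℤ/ℓ` in characteristic prime to `ℓ`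
(Reynolds / isotypic projections, invariant lattices of diagonal torus-like actions) for PARTS A–C2;
Kummer theory (`X^ℓ − a` separable), the simple-root criterion and transcendence degree (`k(W)`
purely transcendental) for PART F; nothing else.

CUT (kernel, exact modulo THEOREM D): `NonKHToricArchLUKeyHenselDescent e c n ↔
NonKHToricArchLUKeyHenselDescentKummer e c n` (`nonKHToricArchLUKeyHenselDescent_iff_kummer`, PART
E) and one rung further `↔ NonKHToricArchLUKeyHenselDescentEigen e c n`
(`nonKHToricArchLUKeyHenselDescent_iff_eigen`, PART H: the residual OFF THE EIGEN-CELL, `R24⁺`), the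
cell pieces being decided by `nonKHToricArchLUKeyHenselDescentKummerCell_of_theoremD` /
`…EigenCell_of_theoremD`; the directions residual ⇒ new residuals are hypothesis-free
(`…Kummer_of_descent`, `…Eigen_of_kummer`).  ROOT BY NAME: `closes_kummer` and `closes_eigen`
(pieces: CP-floor, CJS, Π₁, `TheoremDAll`, the new residual family, 0642) and, hypothesis-free in D,
`closes_descent_reexport` (g23's residual family).

TAGS.  `eigenCoordinate_of_stableHyperplane`, `eigenFrame_of_stableFlag`,
`kummerFrame_of_stableHyperplane`, `orbitCocycle_of_step`, `mem_of_fixed`,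
`fixed_iff_mem_adjoin_invGen`, `algebraicIndependent_invGen`, `tameEigenChartBelow_of_stableFlag`
DECIDED (kernel, no hypothesis) · `galoisHenselDescentDatum_of_diagonalChart` / `_of_stableFlag` /
`_of_kummerChart` / `_of_stableHyperplane` DECIDED-MOD-D (`TheoremD k` typed hypothesis, = g21
rank-2 item, UNDECIDED · ATTACKABLE) · `TameEigenChartBelow`, `TameKummerChartBelow` INSTRUMENTABLE
cells · `NonKHToricArchLUKeyHenselDescentKummer` (`R24`) and `NonKHToricArchLUKeyHenselDescentEigen`
(`R24⁺`, weaker) UNDECIDED, WEAKER than the root (`…Kummer_of_root`, `…Eigen_of_root`), located at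
`(3, 3, 4)`. NEXT (not in this file): the `ε ≥ 1` rungs WITHOUT first-order stability (Cartan
linearisation in `A_𝔮`, tree `exists_eigen_regularParameters_of_tameCyclic`, plus a value-adaptation
step: the linearised parameters need not be value-adapted), characters with no primitive coordinate
(`gcd(tⱼ, ℓ) > 1` for all `j`: compose prime-order steps), and Π₁ `KK05NCVAscent` in kernel (the
window's NEXT MAP).

[WRITER NOTE (decomp-res writer g12): the gate caps Theorems files with proofs at 400 lines, so the
lens's tree file `EigenLadderLU.lean` (470 l, sha256 2160ec60…) is landed as TWO modules split at a
namespace-block boundary — `EigenLadderLU` (PART A twisted Reynolds operators) and `EigenLadderLU1B`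
(PART C1 invariants of a diagonal tame action) — content VERBATIM (plus bookkeeping docstrings on
undocumented simp lemmas); the node's import chain becomes EigenLadderLU → EigenLadderLU1B →
EigenLadderLU2 → EigenLadderLU2B → EigenLadderLU3 → EigenLadderLU4 → EigenLadderLU5 →
EigenLadderLU5B → EigenLadderLU6 (one namespace `…Theorems.EigenLadderLU` throughout).]
-/
/-! ==================== g24 NEW CONTENT BEGINS HERE ==================== -/

namespace Summit.ResolutionOfSingularities.ResolutionOfSingularities.Theorems.EigenLadderLU

open Polynomial

/-! ## PART A — twisted Reynolds operators of a tame cyclic automorphism of a field (character grading) -/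

section Reynolds

variable {k : Type} [Field k] {L : Type} [Field L] [Algebra k L]

/-- Iterates of an algebra automorphism fix the base field elements. [folklore] -/
theorem pow_apply_algebraMap (σ : L ≃ₐ[k] L) (i : ℕ) (c : k) :
    (σ ^ i) (algebraMap k L c) = algebraMap k L c :=
  (σ ^ i).commutes c

/-- `σ^{i+1} y = σ (σ^i y)`. [folklore] -/
theorem pow_succ_apply (σ : L ≃ₐ[k] L) (i : ℕ) (y : L) : (σ ^ (i + 1)) y = σ ((σ ^ i) y) := by
  rw [pow_succ', AlgEquiv.mul_apply]

/-- The **twisted Reynolds operator** `P_t y = ∑_{i<ℓ} ζ′^{t i} σⁱ y` (`ζ′ = ζ⁻¹`) of a cyclic automorphism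
`σ` of order dividing `ℓ`: the projector onto the `ζ^t`-eigenspace (up to the factor `ℓ`).
[CossartPiltant2008, proof of Prop. 6.2 (2), (29)–(30)] [folklore] -/
def reynolds (σ : L ≃ₐ[k] L) (ζ' : k) (ℓ t : ℕ) (y : L) : L :=
  ∑ i ∈ Finset.range ℓ, algebraMap k L (ζ' ^ (t * i)) * (σ ^ i) y

/-- `reynolds_def`: Bookkeeping / simp lemma of the eigen-ladder kernel (decomp-res lens-1 g24 «EigenLadder»),
VERBATIM from the lens's tree file (see the module docstring); the statement is its type. [folklore] -/
theorem reynolds_def (σ : L ≃ₐ[k] L) (ζ' : k) (ℓ t : ℕ) (y : L) :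
    reynolds σ ζ' ℓ t y = ∑ i ∈ Finset.range ℓ, algebraMap k L (ζ' ^ (t * i)) * (σ ^ i) y := rfl

/-- The Reynolds operator preserves any `σ`-stable `k`-subalgebra. [folklore] -/
theorem reynolds_mem (σ : L ≃ₐ[k] L) (ζ' : k) (ℓ t : ℕ) (A : Subalgebra k L)
    (hA : ∀ a ∈ A, σ a ∈ A) {y : L} (hy : y ∈ A) : reynolds σ ζ' ℓ t y ∈ A := by
  have hpow : ∀ i : ℕ, (σ ^ i) y ∈ A := by
    intro i
    induction i with
    | zero => simpa using hy
    | succ i ih => rw [pow_succ_apply]; exact hA _ ih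
  refine Subalgebra.sum_mem _ fun i _ => Subalgebra.mul_mem _ (Subalgebra.algebraMap_mem _ _) (hpow i)

/-- **Eigen property**: `σ (P_t y) = ζ^t · P_t y` when `σ^ℓ = 1`, `ζ ζ′ = 1`, `ζ^ℓ = 1`. [folklore] -/
theorem sigma_reynolds (σ : L ≃ₐ[k] L) {ℓ : ℕ} (hℓ : 0 < ℓ) (hσℓ : σ ^ ℓ = 1) (ζ ζ' : k)
    (hζζ' : ζ * ζ' = 1) (hζℓ : ζ ^ ℓ = 1) (t : ℕ) (y : L) :
    σ (reynolds σ ζ' ℓ t y) = algebraMap k L (ζ ^ t) * reynolds σ ζ' ℓ t y := by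
  classical
  have hζ'ℓ : ζ' ^ ℓ = 1 := by
    have h1 : (ζ * ζ') ^ ℓ = 1 := by rw [hζζ', one_pow]
    rwa [mul_pow, hζℓ, one_mul] at h1
  rw [reynolds_def, map_sum, Finset.mul_sum]
  -- `f i := ζ^t ζ'^{t i} σ^i y`; LHS = ∑ f (i+1), RHS = ∑ f i, and `f ℓ = f 0`
  let f : ℕ → L := fun i => algebraMap k L (ζ ^ t * ζ' ^ (t * i)) * (σ ^ i) y
  have hf : ∀ i, σ (algebraMap k L (ζ' ^ (t * i)) * (σ ^ i) y) = f (i + 1) := by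
    intro i
    rw [map_mul, AlgEquiv.commutes, ← pow_succ_apply]
    change _ = algebraMap k L (ζ ^ t * ζ' ^ (t * (i + 1))) * (σ ^ (i + 1)) y
    congr 1
    rw [mul_add, mul_one, pow_add, ← mul_assoc, mul_comm (ζ ^ t), mul_assoc, ← mul_pow,
      hζζ', one_pow, mul_one]
  have hg : ∀ i, algebraMap k L (ζ ^ t) * (algebraMap k L (ζ' ^ (t * i)) * (σ ^ i) y) = f i := by
    intro i
    change _ = algebraMap k L (ζ ^ t * ζ' ^ (t * i)) * (σ ^ i) y
    rw [map_mul, mul_assoc]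
  simp only [hf, hg]
  have hfℓ : f ℓ = f 0 := by
    change algebraMap k L (ζ ^ t * ζ' ^ (t * ℓ)) * (σ ^ ℓ) y =
      algebraMap k L (ζ ^ t * ζ' ^ (t * 0)) * (σ ^ 0) y
    rw [mul_comm t ℓ, pow_mul, hζ'ℓ, one_pow, mul_zero, pow_zero, hσℓ, pow_zero]
  obtain ⟨m, hm⟩ : ∃ m, ℓ = m + 1 := ⟨ℓ - 1, by omega⟩
  rw [hm, Finset.sum_range_succ' f, Finset.sum_range_succ (fun i => f (i + 1)), ← hm, hfℓ]

/-- Character orthogonality: `∑_{t<ℓ} ζ′^{t i} = 0` for `0 < i < ℓ`, `ζ′` a primitive `ℓ`-th root of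
unity. [folklore] -/
theorem sum_pow_mul_eq_zero {ζ' : k} {ℓ : ℕ} (hζ' : IsPrimitiveRoot ζ' ℓ) {i : ℕ} (hi : 0 < i)
    (hiℓ : i < ℓ) : ∑ t ∈ Finset.range ℓ, ζ' ^ (t * i) = 0 := by
  have hne : ζ' ^ i ≠ 1 := hζ'.pow_ne_one_of_pos_of_lt hi.ne' hiℓ
  have h1 : (∑ t ∈ Finset.range ℓ, (ζ' ^ i) ^ t) * (ζ' ^ i - 1) = 0 := by
    rw [geom_sum_mul, ← pow_mul, mul_comm, pow_mul, hζ'.pow_eq_one, one_pow, sub_self]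
  have h2 : ∑ t ∈ Finset.range ℓ, (ζ' ^ i) ^ t = 0 :=
    (mul_eq_zero.mp h1).resolve_right (sub_ne_zero.mpr hne)
  rw [← h2]
  exact Finset.sum_congr rfl fun t _ => by rw [← pow_mul, mul_comm]

/-- **Reynolds decomposition**: `∑_{t<ℓ} P_t y = ℓ · y` (`ζ′` a primitive `ℓ`-th root of unity). [folklore] -/
theorem sum_reynolds (σ : L ≃ₐ[k] L) {ζ' : k} {ℓ : ℕ} (hℓ : 0 < ℓ) (hζ' : IsPrimitiveRoot ζ' ℓ)
    (y : L) : ∑ t ∈ Finset.range ℓ, reynolds σ ζ' ℓ t y = (ℓ : L) * y := by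
  classical
  simp only [reynolds_def]
  rw [Finset.sum_comm]
  -- inner sum over `t`: `(∑_t ζ'^{t i}) σ^i y`
  have hinner : ∀ i ∈ Finset.range ℓ,
      ∑ t ∈ Finset.range ℓ, algebraMap k L (ζ' ^ (t * i)) * (σ ^ i) y =
        if i = 0 then (ℓ : L) * y else 0 := by
    intro i hi
    rw [← Finset.sum_mul, ← map_sum]
    split_ifs with h0
    · subst h0
      simp
    · rw [sum_pow_mul_eq_zero hζ' (Nat.pos_of_ne_zero h0) (Finset.mem_range.mp hi), map_zero,
        zero_mul]
  rw [Finset.sum_congr rfl hinner, Finset.sum_ite_eq' (Finset.range ℓ) 0, if_pos (Finset.mem_range.mpr hℓ)]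

/-- Reynolds operator of an element whose `σ`-iterates are multiples of it:
`σⁱ u = cᵢ u ⟹ P_t u = (∑ ζ′^{ti} cᵢ) u`. [folklore] -/
theorem reynolds_eq_mul_of_iterates (σ : L ≃ₐ[k] L) (ζ' : k) (ℓ t : ℕ) {u : L} (c : ℕ → L)
    (hc : ∀ i, i < ℓ → (σ ^ i) u = c i * u) :
    reynolds σ ζ' ℓ t u = (∑ i ∈ Finset.range ℓ, algebraMap k L (ζ' ^ (t * i)) * c i) * u := by
  rw [reynolds_def, Finset.sum_mul]
  exact Finset.sum_congr rfl fun i hi => by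
    rw [hc i (Finset.mem_range.mp hi), mul_assoc]

end Reynolds

end Summit.ResolutionOfSingularities.ResolutionOfSingularities.Theorems.EigenLadderLU
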